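/-
Copyright (c) 2026 the pub-hodgecm-mathlib formalisation cell (harness21).  Prover seat hodgecm-mathlib-LH4-p12 (g8), req620 Track A «(D-RAM) FOUR-FRAME» squad
((β₂) road (R-36), LANE C (RamM): the PARITY LETTER `hpar` of the (OFF_C) wrapper ★ `offRowC_holds_of_lines`, DISCHARGED), 2026-09-05.
-/
import Summits.HodgeConjecture.HodgeConjecture.Theorems.F0P3cDyRamRowCleanCellBit              -- ★ p863209 (LH4-p06 (g9)): `line_entry_mul_map_eq_one` (`u₀₀·σu₀₀ = 1` from the frame); brings the OFF vocabulary
import Literature.NumberTheory.LocalFields.WildQuadraticDatumNormOneQuotient                   -- ★ (B0): `exists_v_sub_one_eq_pow` (a norm-one unit `dΘ` digits deep has depth `dΘ + 2j`)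
import HarnessLib

/-!
# Crux `H413`, line LH4 «(D-RAM) FOUR-FRAME» — STAGE-1b, row (2) of `f_{T₊}`, the (β₂) road «PURE-CELL LEDGER» (R-36), LANE C (RamM) —
# THE PARITY LETTER OF THE (OFF_C) WRAPPER: `m = v_M(lam − jE u₀₀)` IS EVEN

Cell `hodgecm-mathlib` (D-0151), FLOOR 0, crux item H413 = `stmt-HodgeConjecture-24833`, route of record `HCCMUnconditional`; squads F0∕P3c∕LH4 ∕ LH7; lane
`--supports stmt-HodgeConjecture-24833 --as helper` (count-neutral; pays NO tier-0 row).  THEOREMS ONLY (no `def`, no instance, no notation, no `sorry`, default heartbeats);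
★-only imports; states NO law.

WHAT.  The lane-C (OFF_C) wrapper ★ p863600 `…F0P3cDyRamBeta2ConesOffRowCOfLines.offRowC_holds_of_lines (N) (hpar) (hEvenRow) (hTop) (hLow) : ‹OFF_C.letter.v2›` takes the parity
letter `hpar` = «over `OFF_C.letter.v2`'s binder block, `m % 2 = 0`» (LH4-p16 (g2)'s rider; F0P3-p01 (g37) 2026-09-04T23:24:33Z numerics: `v_M(lam − jE u₀₀)` is even).  THIS FILE PAYS IT for
every fence schedule `N` with `2d ≤ N d t` (implied by LH7-p10 (g2)'s lane-C floor `mstarOfRecord d + t + 1 ≤ N d t`):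
* §1 `depth_even_of_letters_ramM` — line model `(M, jE, Θ)` with `Θ ∘ jE = jE ∘ σ`, a ramified datum `(Θ, ϖM, dΘ, t)` ON `M` with `dΘ = 2g`, the torus equations `Θ(lam)·lam = 1`,
  `u₀·σu₀ = 1`, and `|lam − jE u₀| = exp(−m)` with `dΘ ≤ m` ⟹ `m % 2 = 0`.  Proof: `ν := lam ∕ jE u₀` is `Θ`-unitary with `|ν − 1| = |ϖM|^m ≤ |ϖM|^{dΘ}`, so ★ `exists_v_sub_one_eq_pow`
  gives `|ν − 1| = |ϖM|^{dΘ + 2j}`, i.e. `m = dΘ + 2j`.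
* §2 HEAD `parC_holds (N) (hN : ∀ d t, 2 * d ≤ N d t)` : the parity letter VERBATIM (`OFF_C.letter.v2` a2c0234d7b04450d lines 4–50 BYTE FOR BYTE, then `m % 2 = 0`) — §1 at the letter's
  binders: `u₀₀·σu₀₀ = 1` by ★ `line_entry_mul_map_eq_one` (`_hA _hΓ`, `h_W ≠ 0`), the datum `_c8`, `dΘ = 2g` (`_c21`), and `dΘ = 2g ≤ 2(g + s0) = 2d ≤ N d tE ≤ m` (`_c25`, `_hNm`).
So lane C reads `offRowC_holds_of_lines N (parC_holds N hN) ‹hEvenRow› ‹hTop› ‹hLow›`: the (OFF_C) residue is the three cell-sets only.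
HONEST LABEL.  Count-neutral; nothing printed is asserted; no census law is stated; `hEvenRow`, `hTop`, `hLow`, (ROW_C) and (β₂) stay HYPOTHESES (β₂ UNPROVED); `HC_CM` is proved only
modulo the 7 printed citations (2 remaining named inputs: hLiu418 = `stmt-HodgeConjecture-24832`, h413 = `stmt-HodgeConjecture-24833`) until rung 0 closes.
## References
* [Serre1979] J.-P. Serre, *Local Fields*, GTM 67 (1979): Ch. V §3 (the filtration of the norm-one units of a ramified quadratic extension; depths of norm-one units).
* [Rogawski1990] J. Rogawski, *Automorphic Representations of Unitary Groups in Three Variables*, Ann. of Math. Stud. 123 (1990): §4.8 Case (a) p. 53, §4.9 Prop. 4.9.1 (b) p. 55.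
* [Kottwitz1986BaseChangeUnits] R. E. Kottwitz, *Base change for unit elements of Hecke algebras*, Compositio Math. 60 (1986): §1 pp. 240–241.
-/

set_option autoImplicit false

noncomputable section

namespace Summit.HodgeConjecture.HodgeConjecture.Cruxes.H413.F0P3cDyRamBeta2ConesOffRowCParity

open scoped Valued WithZero Matrix MatrixGroups Pointwise Classical
open WithZero
open Literature.NumberTheory.Automorphic Literature.NumberTheory.Automorphic.HermitianLattice Literature.NumberTheory.Automorphic.UnitaryLatticeTree
open Literature.NumberTheory.Automorphic.UnitaryThreeFourFrame (IsRamifiedQuadraticDatum)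
open Literature.NumberTheory.Rogawski1990
open Literature.NumberTheory.LocalFields.WildQuadraticDatum (exists_v_sub_one_eq_pow v_eq_one_of_v_mul_map_eq_one)
open Summit.HodgeConjecture.HodgeConjecture.Cruxes.H413.F0P3cDyRamFourFramePieces
open Summit.HodgeConjecture.HodgeConjecture.Cruxes.H413.F0P3cDyRamFourFrameCensusDefs (LatticeInLevel LatticeNearTransvShell)
open Summit.HodgeConjecture.HodgeConjecture.Cruxes.H413.F0P3cDyRamStageOneBDefs (mcOfRecord)
open Summit.HodgeConjecture.HodgeConjecture.Cruxes.H413.F0P3cDyRamToricCensusDefs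
open Summit.HodgeConjecture.HodgeConjecture.Cruxes.H413.F0P3cDyRamRowCleanCellBit (line_entry_mul_map_eq_one)

/-! ## §1 The depth of a line vertex scalar is even in the RamM lane -/

/-- **`m` IS EVEN IN LANE C.**  Letters: `Θ ∘ jE = jE ∘ σ`; a ramified datum `(Θ, ϖM, dΘ, t)` on `M` (`|ϖM| = exp(−1)`, `Θ`-fixed elements of even order, `|ϖM − ΘϖM| = |ϖM|^{dΘ}`) with `dΘ = 2g`;
`Θ(lam)·lam = 1`, `u₀·σu₀ = 1`, `|lam − jE u₀| = exp(−m)`, `dΘ ≤ m`.  THEN `m % 2 = 0`: `ν := lam∕jE u₀` is `Θ`-unitary, `ν ≠ 1`, `|ν − 1| = |ϖM|^m ≤ |ϖM|^{dΘ}`, and ★ `exists_v_sub_one_eq_pow`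
reads `|ν − 1| = |ϖM|^{dΘ + 2j}`. [cite: Serre1979, Ch. V §3] -/
theorem depth_even_of_letters_ramM {E M : Type} [Field E] [Field M] [Valued M ℤᵐ⁰] {σ : E →+* E} {Θ : M →+* M}
    (jE : E →+* M) (hΘj : ∀ c, Θ (jE c) = jE (σ c)) {ϖM : M} {dΘ t : ℕ} (hDM : IsRamifiedQuadraticDatum Θ ϖM dΘ t) {g : ℕ} (hg2 : dΘ = 2 * g)
    {lam : M} (hΘlam : Θ lam * lam = 1) {u₀ : E} (huu : u₀ * σ u₀ = 1)
    {m : ℕ} (hm : Valued.v (lam - jE u₀) = exp (-(m : ℤ))) (hgm : dΘ ≤ m) : m % 2 = 0 := by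
  obtain ⟨hΘΘ, hvΘ, hπ, heven, hdd, hd1, -⟩ := id hDM
  have hu0 : jE u₀ ≠ 0 := fun h0 => by
    have := congrArg jE huu; rw [map_mul, map_one, ← hΘj, h0, zero_mul] at this; exact zero_ne_one this
  have hΘu : jE u₀ * Θ (jE u₀) = 1 := by rw [hΘj, ← map_mul, huu, map_one]
  have hlamΘ : lam * Θ lam = 1 := by rw [mul_comm]; exact hΘlam
  set ν : M := lam / jE u₀ with hν
  have hνu : ν * Θ ν = 1 := by rw [hν, map_div₀, div_mul_div_comm, hlamΘ, hΘu, div_one]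
  have hvu : Valued.v (jE u₀) = 1 := v_eq_one_of_v_mul_map_eq_one hvΘ (by rw [hΘu, Valuation.map_one])
  have hν1 : Valued.v (ν - 1) = Valued.v ϖM ^ m := by
    rw [hν, div_sub_one hu0, Valuation.map_div, hvu, div_one, hm, hπ, ← exp_nsmul, nsmul_eq_mul, mul_neg, mul_one]
  have hϖM1 : Valued.v ϖM ≤ 1 := by rw [hπ, ← exp_zero, exp_le_exp]; norm_num
  have hne : ν ≠ 1 := fun h1 => by
    have h0 : Valued.v (ν - 1) = 0 := by rw [h1, sub_self, Valuation.map_zero]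
    rw [hν1] at h0
    exact pow_ne_zero m (by rw [hπ]; exact exp_ne_zero) h0
  obtain ⟨j, hj⟩ := exists_v_sub_one_eq_pow hΘΘ hvΘ heven hπ hdd hd1 hνu (by rw [hν1]; exact pow_le_pow_right_of_le_one' hϖM1 hgm) hne
  rw [hν1, hπ, ← exp_nsmul, ← exp_nsmul, nsmul_eq_mul, nsmul_eq_mul] at hj
  have := exp_injective hj
  push_cast at this
  omega

/-! ## §2 HEAD — the parity letter of ★ `offRowC_holds_of_lines`, for every fence `N` with `2d ≤ N d t` -/

/-- **THE PARITY LETTER `hpar` OF THE LANE-C (OFF_C) WRAPPER, PAID** for every fence schedule `N : ℕ → ℕ → ℕ` with `hN : ∀ d t, 2 * d ≤ N d t`: over `OFF_C.letter.v2`'s binder block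
(a2c0234d7b04450d, lines 4–50 BYTE FOR BYTE), `m % 2 = 0` — §1 at the letter's binders (`u₀₀·σu₀₀ = 1` by ★ `line_entry_mul_map_eq_one`; the datum `_c8`; `dΘ = 2g ≤ 2d ≤ N d tE ≤ m`
by `_c21 _c25 _hNm`).  Feeds `offRowC_holds_of_lines N (parC_holds N hN)`. [cite: Serre1979, Ch. V §3] [cite: Rogawski1990, §4.8 Case (a) p. 53] -/
theorem parC_holds (N : ℕ → ℕ → ℕ) (hN : ∀ d t : ℕ, 2 * d ≤ N d t) :
      ∀ (E M : Type) [Field E] [Valued E ℤᵐ⁰] [CompleteSpace E] [IsDiscreteValuationRing 𝒪[E]] [Finite 𝓀[E]]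
        [Field M] [Valued M ℤᵐ⁰] [CompleteSpace M] [IsDiscreteValuationRing 𝒪[M]] [Finite 𝓀[M]]
        (σ : E →+* E) (ϖ : E) (d tE : ℕ) (_hD : IsRamifiedQuadraticDatum σ ϖ d tE) (_hσσ : ∀ a, σ (σ a) = a) (_h2 : ¬ IsUnit (2 : 𝒪[E]))
        (jE : E →+* M) (ρ Θ : M →+* M) (α lam : M)
        (_hρρ : ∀ z, ρ (ρ z) = z) (_hvρ : ∀ z, Valued.v (ρ z) = Valued.v z) (_hρj : ∀ a, ρ (jE a) = jE a)
        (_hjv : ∀ a, Valued.v (jE a) ≤ 1 ↔ Valued.v a ≤ 1) (_hjfix : ∀ z : M, ρ z = z ↔ ∃ a, jE a = z) (_hΘj : ∀ a, Θ (jE a) = jE (σ a))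
        (_hΘΘ : ∀ z, Θ (Θ z) = z) (_hΘρ : ∀ z, Θ (ρ z) = ρ (Θ z)) (_hvΘ : ∀ z, Valued.v (Θ z) = Valued.v z)
        (_hα : ρ α ≠ α) (_hα1 : Valued.v α ≤ 1) (_hint : ∀ z : M, Valued.v z ≤ 1 → Valued.v ((z - ρ z) / (α - ρ α)) ≤ 1)
        (_hΘlam : Θ lam * lam = 1) (_hvlam : Valued.v lam = 1) (_hbasis : ∀ z : M, ∃! pq : E × E, z = jE pq.1 + jE pq.2 * lam)
        (_hC : Valued.v (α - ρ α) < 1) (ϖM c₀ n₀ : M) (dρ dΘ dτ g s0 dK d' : ℕ)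
        (_c1 : ∀ a, Valued.v (jE a) = Valued.v a ^ 2) (_c2 : Nat.card 𝓀[M] = Nat.card 𝓀[E]) (_c3 : ∀ z : M, Valued.v z ≤ 1 → Valued.v (z - Θ z) < 1) (_c4 : ∀ z : M, Valued.v z ≤ 1 → Valued.v (z - Θ (ρ z)) < 1)
        (_c5 : Valued.v ϖM = WithZero.exp (-1 : ℤ)) (_c6 : α - ρ α = ϖM - ρ ϖM) (_c7 : IsRamifiedQuadraticDatum ρ ϖM dρ (2 * tE)) (_c8 : IsRamifiedQuadraticDatum Θ ϖM dΘ (2 * tE)) (_c9 : 1 ≤ dτ)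
        (_c10 : Valued.v (ϖM - Θ (ρ ϖM)) = Valued.v ϖM ^ dτ) (_c11 : Θ c₀ = c₀) (_c12 : Valued.v c₀ = 1) (_c13 : ∀ x : M, Θ x = x → Valued.v x = 1 → (∃ z : M, z * Θ z = x) ∨ ∃ z : M, z * Θ z = c₀ * x)
        (_c14 : ∀ f₀ : M, ρ f₀ = f₀ → Θ f₀ = f₀ → Valued.v f₀ = 1 → ∃ z : M, z * Θ z = f₀) (_c15 : Θ n₀ = n₀) (_c16 : Valued.v n₀ = 1) (_c17 : ¬ ∃ z : M, z * Θ z = n₀)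
        (_c18 : ∀ x : M, ρ x = x → Θ (ρ x) = x → x ≠ 0 → ∃ n : ℤ, Valued.v x = WithZero.exp (4 * n)) (_c19 : ∀ z : M, ρ z = z → Θ z = z → z ≠ 0 → ∃ n : ℤ, Valued.v z = WithZero.exp (4 * n))
        (_c20 : ∃ a : M, Θ a = a ∧ Valued.v a = 1 ∧ ¬ ∃ e : M, ρ e = e ∧ e * Θ e = a * ρ a) (_c21 : dΘ = 2 * g) (_c22 : dτ = 2 * s0) (_c23 : 1 ≤ g) (_c24 : 1 ≤ s0) (_c25 : g + s0 = d)
        (_c26 : Valued.v (ϖM * Θ (ρ ϖM) - ρ (ϖM * Θ (ρ ϖM))) = WithZero.exp (-(2 * (dK : ℤ)))) (_c27 : 2 * dK = dρ + 2 * g)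
        (_c28 : Valued.v (ϖM * Θ ϖM - ρ (ϖM * Θ ϖM)) = WithZero.exp (-(2 * (d' : ℤ)))) (_c29 : 2 * d' = dρ + dτ) (_hjpow : ∀ (t : E) (n : ℤ), Valued.v (jE t) = Valued.v (jE ϖ) ^ n ↔ Valued.v t = Valued.v ϖ ^ n)
        (_hEval : ∀ c : M, ρ c = c → c ≠ 0 → Valued.v c ≤ 1 → ∃ n : ℕ, Valued.v c = Valued.v (jE ϖ) ^ n)
        (_hϖmax : ∀ t : M, ρ t = t → Valued.v t < 1 → Valued.v t ≤ Valued.v (jE ϖ))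
        (γ₂ : GL (Fin 2) E) (u : GL (Fin 1) E)
        (_hdet : (γ₂ : Matrix (Fin 2) (Fin 2) E).det * σ (γ₂ : Matrix (Fin 2) (Fin 2) E).det = 1)
        (_htr : (γ₂ : Matrix (Fin 2) (Fin 2) E).trace = (γ₂ : Matrix (Fin 2) (Fin 2) E).det * σ (γ₂ : Matrix (Fin 2) (Fin 2) E).trace)
        (_hirr : ∀ x : E, x * x - (γ₂ : Matrix (Fin 2) (Fin 2) E).trace * x + (γ₂ : Matrix (Fin 2) (Fin 2) E).det ≠ 0)
        (_hlam2 : lam * lam = jE (γ₂ : Matrix (Fin 2) (Fin 2) E).trace * lam - jE (γ₂ : Matrix (Fin 2) (Fin 2) E).det)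
        (_hρlam : ρ lam = jE (γ₂ : Matrix (Fin 2) (Fin 2) E).trace - lam) (m jl : ℕ) (_hm : Valued.v (lam - jE ((u : Matrix (Fin 1) (Fin 1) E) 0 0)) = WithZero.exp (-(m : ℤ)))
        (_hjl : Valued.v ((lam - jE ((u : Matrix (Fin 1) (Fin 1) E) 0 0)) - ρ (lam - jE ((u : Matrix (Fin 1) (Fin 1) E) 0 0))) = WithZero.exp (-(jl : ℤ)))
        (_hs : Valued.v ((γ₂ : Matrix (Fin 2) (Fin 2) E).trace - 2) * Valued.v (ϖ ^ (d % 2)) ≤ Valued.v (ϖ ^ mcOfRecord d))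
        (_hp : Valued.v ((γ₂ : Matrix (Fin 2) (Fin 2) E).det - (γ₂ : Matrix (Fin 2) (Fin 2) E).trace + 1) ≤ Valued.v (ϖ ^ mcOfRecord d))
        (_hNm : N d tE ≤ m) (_hu1N : Valued.v (((u : Matrix (Fin 1) (Fin 1) E) 0 0) - 1) ≤ Valued.v (ϖ ^ N d tE)) (_hlam1 : Valued.v (lam - 1) ≤ Valued.v (jE ϖ ^ N d tE))
        (_hu : Valued.v ((u : Matrix (Fin 1) (Fin 1) E) 0 0) = 1) (_hum : Valued.v (((u : Matrix (Fin 1) (Fin 1) E) 0 0) - 1) ≤ Valued.v (ϖ ^ mstarOfRecord d))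
        (H₂ : Matrix (Fin 2) (Fin 2) E) (hW : E) (_hH₂ : IsUnit H₂.det) (_hH₂σ : (H₂.map σ)ᵀ = H₂) (_hhW : Valued.v hW = 1) (_hhWσ : σ hW = hW)
        (P₁ : GL (Fin 3) E) (_hA : formCongr σ P₁ ((StdForm.antidiagonal 3).over E) = (!![H₂ 0 0, 0, H₂ 0 1; 0, hW, 0; H₂ 1 0, 0, H₂ 1 1] : Matrix (Fin 3) (Fin 3) E))
        (_hΓ : P₁ * endoGL (γ₂, u) * P₁⁻¹ ∈ unitaryGroupOfForm σ ((StdForm.antidiagonal 3).over E))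
        (φ : (Fin 2 → E) →+ M) (h : M) (_hφs : ∀ (c : E) (x : Fin 2 → E), φ (c • x) = jE c * φ x) (_hφi : Function.Injective φ) (_hφo : Function.Surjective φ)
        (_hφγ : ∀ x, φ ((γ₂ : Matrix (Fin 2) (Fin 2) E).mulVec x) = lam * φ x)
        (_hform : ∀ x y, jE (pairing σ H₂ x y) = h * Θ (φ x) * φ y + ρ (h * Θ (φ x) * φ y)) (_hΘh : Θ h = h) (_hh : h ≠ 0)
        (J R : ℕ) (f : ℕ → ℕ → AddSubgroup M → ℕ)
        (_hfinF : {L₃ : Submodule 𝒪[E] (Fin 3 → E) | IsSelfDualLattice σ ϖ (!![H₂ 0 0, 0, H₂ 0 1; 0, hW, 0; H₂ 1 0, 0, H₂ 1 1] : Matrix (Fin 3) (Fin 3) E) L₃ ∧ mapGL (endoGL (γ₂, u)) L₃ = L₃}.Finite)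
        (_hR : ∀ L₃ : Submodule 𝒪[E] (Fin 3 → E), IsSelfDualLattice σ ϖ (!![H₂ 0 0, 0, H₂ 0 1; 0, hW, 0; H₂ 1 0, 0, H₂ 1 1] : Matrix (Fin 3) (Fin 3) E) L₃ →
          mapGL (endoGL (γ₂, u)) L₃ = L₃ → ∀ b : ℕ, (∀ c : E, (Pi.single 1 c : Fin 3 → E) ∈ L₃ ↔ Valued.v c ≤ Valued.v ϖ ^ b) → b ≤ R)
        (_hJ : ¬ IsOrd ρ α (jE ϖ ^ (J + 1)) lam) (_hfinLS : ∀ j a, (levelSet ρ Θ α (jE ϖ) h j a).Finite)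
        (_hf : ∀ (b j : ℕ) (Λ : AddSubgroup M) (x₀ : M) (r : E), 1 ≤ b → x₀ ≠ 0 → (∀ x, x ∈ Λ ↔ ∃ z, IsOrd ρ α (jE ϖ ^ j) z ∧ x = x₀ * z) →
          IsOrd ρ α (jE ϖ ^ j) (dualGen ρ Θ α (jE ϖ ^ j) h x₀) → ¬ IsOrd ρ α (jE ϖ ^ j) (dualGen ρ Θ α (jE ϖ ^ j) h x₀ / jE ϖ) → Valued.v (dualGen ρ Θ α (jE ϖ ^ j) h x₀) = Valued.v (jE ϖ) ^ b →
          (∀ b', (∀ x ∈ Λ, Valued.v (h * Θ x * b' + ρ (h * Θ x * b')) ≤ 1) → (lam - jE ((u : Matrix (Fin 1) (Fin 1) E) 0 0)) * b' ∈ Λ) → IsOrd ρ α (jE ϖ ^ j) lam →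
          jE r = glueUnit ρ Θ α (jE ϖ ^ j) h (jE ϖ) (jE hW) x₀ b →
          f b j Λ = Nat.card {x : 𝒪[E] ⧸ 𝓂[E] ^ (2 * b) // ∃ u' : 𝒪[E], Ideal.Quotient.mk (𝓂[E] ^ (2 * b)) u' = x ∧ Valued.v ((u' : E) * σ u' - r) ≤ Valued.v (ϖ ^ (2 * b))}),
        m % 2 = 0 := by
  intro E M _ _ _ _ _ _ _ _ _ _ σ ϖ d tE _hD _hσσ _h2 jE ρ Θ α lam _hρρ _hvρ _hρj _hjv _hjfix _hΘj _hΘΘ _hΘρ _hvΘ _hα _hα1 _hint _hΘlam _hvlam _hbasis _hC ϖM c₀ n₀ dρ dΘ dτ g s0 dK d' _c1 _c2 _c3 _c4 _c5 _c6 _c7 _c8 _c9 _c10 _c11 _c12 _c13 _c14 _c15 _c16 _c17 _c18 _c19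
    _c20 _c21 _c22 _c23 _c24 _c25 _c26 _c27 _c28 _c29 _hjpow _hEval _hϖmax γ₂ u _hdet _htr _hirr _hlam2 _hρlam m jl _hm _hjl _hs _hp _hNm _hu1N _hlam1 _hu _hum H₂ hW _hH₂ _hH₂σ _hhW _hhWσ P₁ _hA _hΓ φ h _hφs _hφi _hφo _hφγ _hform _hΘh _hh J R f _hfinF _hR _hJ _hfinLS _hf
  have hhW0 : hW ≠ 0 := fun h0 => by rw [h0, map_zero] at _hhW; exact zero_ne_one _hhW
  have hfl := hN d tE
  exact depth_even_of_letters_ramM jE _hΘj _c8 _c21 _hΘlam (line_entry_mul_map_eq_one σ hhW0 _hA _hΓ) _hm (by omega)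

end Summit.HodgeConjecture.HodgeConjecture.Cruxes.H413.F0P3cDyRamBeta2ConesOffRowCParity

end
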